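import Summits.HodgeConjecture.CorCM.Census.CentralSquaresRelations
import Summits.HodgeConjecture.CorCM.Census.CentralSquaresPartnersMetric

/-!
# The square-central class, LI: the transversal relation `R(T)` at a dihedral-type partner of a MULTI-PARTNER base block

COR-CM (cell `pub-hodgecm2`), count-neutral kernel combinatorics by the binder seat b09 (gen 50; lane SQUARE-CENTRAL CLASS, part LI), on part L
(`Census/CentralSquaresPartnersMetric.lean`: `bpot_eq_card_dev_of_le_m`, `unique_T₀_of_card_lt_m`), part IV (`Census/CentralSquaresTransversal.lean`:
`face_toward_T₀`), part V (`Census/CentralSquaresExchange.lean`: `cover_frame`, `swap_preserves_frame`, `transversal_frame`, `sdiff_eq_of_dev`,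
`exists_type_of_dev`, `card_sdiff_frame`), part VI (`Census/CentralSquaresRelations.lean`: `thetaG_frame`, `card_frame`), part III (`rt_eq_self_of_transversal`,
`eq_of_dev_eq`, `ddist_eq_card_symmDiff`) and gen 32ʼs restricted star reduction `TwistGeneration.single_sub_thetaG_mem_of`, all BY NAME.  Theorems only: no
definition, no `decide`, no certificate, no named fact, no `sorry`.  HONEST FRAMING: `HC_CM` is NOT proved, here or anywhere in the tree; nothing here is a
period or a headline.

THE SETTING (parts XLIX–L).  A base type `T₀` with `|T₀| = 4m` whose base changes are `T₀`, `T̄₀`, the partners `T' ∈ 𝒯` (each with `|T₀ ∖ T'| = 2m`,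
pairwise at distance `2m`) and their complements; ONE partner `T₁ ∈ 𝒯` of DIHEDRAL TYPE: a swap `Q` with `T₀·Q⁻¹ = T₁`, `Q² = 1`, whose place permutation
preserves `𝓗 = T₀ ∖ T₁`; a base-change stable lattice `L` holding a strict lowering cover of `T₀` (part I).  In the rank-two affine blocks of the square-central
rows (`2^{1+4}_+ × E`: all three partners dihedral; Pauli `× E`: two of three; `Q₈ × E`: none) this is the configuration at each dihedral-type partner.

* §1 **STAR NORMAL FORM OF A TRANSVERSAL TYPE, multi-partner form** (`single_sub_thetaG_mem_transversal_partners`, `m ≥ 2`): for a transversal `T ⊆ 𝓗` of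
  the swap with `|T| = m` such that at the type `Φ_T` with deviation set `T` the only base changes at distance `m` are `T₀` and `T₁` (`htie` — in the affine
  blocks: `0 < |T ∩ 𝓗'| < m` for every other partner `T'`), every type `X` with `D(X) ⊆ T` has `[X] − θ_{T₀}(typeSum [X]) ∈ L`.  Part IVʼs proof verbatim,
  with part Lʼs multi-partner metric in place of the four-type metric: below level `m` the nearest base change is unique WHATEVER the partners.
* §2 The exchanged frame `(T₁; T₀, Q)` is again a multi-partner frame (`hbase_exchange_partners`, partners `insert T₀ (𝒯.erase T₁)`), so the same holds
  toward `T₁` (`single_sub_thetaG_mem_transversal_partners_exchange`).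
* §3 **THE TRANSVERSAL RELATION** (`rel_transversal_mem_partners`): `R(T) = Σ_{s∈T} f_s − Σ_{u∈𝓗∖T} g_u − (m−1)(e₀ − e₁) ∈ L` — the first of the four
  relation families part XLIXʼs multi-partner closure asks for, at every dihedral-type partner.

NUMERICS (`HOME/pub-hodgecm2-b09/lean-g50/py/eight3.py`, `n = 16`, `m = 4`): in `2^{1+4}_+` and Pauli `× ℤ/2`, for every dihedral-type swap at every partner,
`R(T) ∈ L` for ALL `16` transversals `T` of the swap (canonical cover) — including the `T` with `|T ∩ 𝓗'| ∈ {0, m}` excluded by `htie` here.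

## References
* [Pohlmann1968] H. Pohlmann, Algebraic cycles on abelian varieties of complex multiplication type, Ann. of Math. 88 (1968), Thm 1.
-/

namespace Summit.HodgeConjecture.CorCM.Census.CentralSquares

open Finset
open scoped symmDiff
open Summit.HodgeConjecture.CorCM.Prior.AllgGroup.RfwfAllgGroup
open Summit.HodgeConjecture.CorCM.Census.BlockParity
open Summit.HodgeConjecture.CorCM.Census.Coinvariant
open Summit.HodgeConjecture.CorCM.Census.TwistGeneration
open Summit.HodgeConjecture.CorCM.Census.BaseBlock
open Summit.HodgeConjecture.CorCM.Census.CoverClosure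

noncomputable section

variable {G : Type*} [Group G] [Fintype G] [DecidableEq G] (c : G)

/-! ## §0 The exchanged multi-partner frame -/

/-- **The base block seen from a partner** `T₁ = T₀·Q⁻¹`: its base changes are `T₁`, `T̄₁`, and the types of `insert T₀ (𝒯.erase T₁)` with their
complements. [folklore] -/
theorem hbase_exchange_partners {T₀ : CMF G c} {𝒯 : Finset (CMF G c)}
    (hbase : ∀ Q : G, rt c Q T₀ = T₀ ∨ rt c Q T₀ = rt c c T₀ ∨ ∃ T₁ ∈ 𝒯, rt c Q T₀ = T₁ ∨ rt c Q T₀ = rt c c T₁)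
    {T₁ : CMF G c} {Q : G} (hQ : rt c Q T₀ = T₁) :
    ∀ Q' : G, rt c Q' T₁ = T₁ ∨ rt c Q' T₁ = rt c c T₁ ∨
      ∃ T₂ ∈ insert T₀ (𝒯.erase T₁), rt c Q' T₁ = T₂ ∨ rt c Q' T₁ = rt c c T₂ := by
  classical
  intro Q'
  have e : rt c Q' T₁ = rt c (Q' * Q) T₀ := by rw [rt_mul, hQ]
  rw [e]
  rcases hbase (Q' * Q) with h | h | ⟨T₂, hT₂, h | h⟩
  · exact Or.inr (Or.inr ⟨T₀, mem_insert_self _ _, Or.inl h⟩)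
  · exact Or.inr (Or.inr ⟨T₀, mem_insert_self _ _, Or.inr h⟩)
  · by_cases h12 : T₂ = T₁
    · subst h12; exact Or.inl h
    · exact Or.inr (Or.inr ⟨T₂, mem_insert_of_mem (mem_erase.mpr ⟨h12, hT₂⟩), Or.inl h⟩)
  · by_cases h12 : T₂ = T₁
    · subst h12; exact Or.inr (Or.inl h)
    · exact Or.inr (Or.inr ⟨T₂, mem_insert_of_mem (mem_erase.mpr ⟨h12, hT₂⟩), Or.inr h⟩)

/-- **Partner distances in the exchanged frame**: `|T₁ ∖ T| = 2m` for every `T ∈ insert T₀ (𝒯.erase T₁)` (partners pairwise at distance `2m`). [folklore] -/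
theorem card_sdiff_exchange_partners (hc2 : c * c = 1) (T₀ : CMF G c) (𝒯 : Finset (CMF G c)) (m : ℕ)
    (hH : ∀ T₁ ∈ 𝒯, (T₀.1 \ T₁.1).card = 2 * m)
    (hpair : ∀ T₁ ∈ 𝒯, ∀ T₂ ∈ 𝒯, T₁ ≠ T₂ → ((T₀.1 \ T₁.1) ∆ (T₀.1 \ T₂.1)).card = 2 * m)
    {T₁ : CMF G c} (hT₁ : T₁ ∈ 𝒯) :
    ∀ T ∈ insert T₀ (𝒯.erase T₁), (T₁.1 \ T.1).card = 2 * m := by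
  classical
  intro T hT
  rcases mem_insert.mp hT with rfl | hT'
  · rw [card_sdiff_frame c hc2 T T₁]; exact hH T₁ hT₁
  · obtain ⟨hne, hT𝒯⟩ := mem_erase.mp hT'
    have e : (T₁.1 \ T.1).card = ddist T₁ T := rfl
    rw [e, ddist_eq_card_symmDiff c T₀ hc2 T₁ T]
    exact hpair T₁ hT₁ T hT𝒯 (Ne.symm hne)

section Frame

variable (hc2 : c * c = 1) (hcen : ∀ x : G, x * c = c * x) (T₀ : CMF G c) (𝒯 : Finset (CMF G c))
variable (hbase : ∀ Q : G, rt c Q T₀ = T₀ ∨ rt c Q T₀ = rt c c T₀ ∨ ∃ T₁ ∈ 𝒯, rt c Q T₀ = T₁ ∨ rt c Q T₀ = rt c c T₁)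
variable (m : ℕ) (hn : T₀.1.card = 4 * m) (hH : ∀ T₁ ∈ 𝒯, (T₀.1 \ T₁.1).card = 2 * m)
variable (hpair : ∀ T₁ ∈ 𝒯, ∀ T₂ ∈ 𝒯, T₁ ≠ T₂ → ((T₀.1 \ T₁.1) ∆ (T₀.1 \ T₂.1)).card = 2 * m)
variable (T₁ : CMF G c) (hT₁ : T₁ ∈ 𝒯) (Q : G) (hQ : rt c Q T₀ = T₁) (hQQ : Q * Q = 1)
variable (L : Submodule ℤ (CMF G c →₀ ℤ)) (hLrt : ∀ (Q' : G) (y : CMF G c →₀ ℤ), y ∈ L → Finsupp.mapDomain (rt c Q') y ∈ L)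
variable (hcover : ∀ Ψ : CMF G c, 2 ≤ bpot c T₀ Ψ → ∃ Q₂ s s' : G, bpot c T₀ Ψ = ddist (rt c Q₂ T₀) Ψ ∧
    s ∈ (rt c Q₂ T₀).1 \ Ψ.1 ∧ s' ∈ (rt c Q₂ T₀).1 \ Ψ.1 ∧ s ≠ s' ∧
    gface c hc2 Ψ s s' ∈ L ∧
    ((∃ Q₁ t t' : G, bpot c T₀ Ψ = ddist (rt c Q₁ T₀) Ψ ∧ t ∈ (rt c Q₁ T₀).1 \ Ψ.1 ∧ t' ∈ (rt c Q₁ T₀).1 \ Ψ.1 ∧ t ≠ t' ∧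
        (∀ Q' : G, ddist (rt c Q' T₀) (oflipCM c hc2 t Ψ) = bpot c T₀ (oflipCM c hc2 t Ψ) → rt c Q' T₀ = rt c Q₁ T₀) ∧
        (∀ Q' : G, ddist (rt c Q' T₀) (oflipCM c hc2 t' Ψ) = bpot c T₀ (oflipCM c hc2 t' Ψ) → rt c Q' T₀ = rt c Q₁ T₀) ∧
        (∀ Q' : G, ddist (rt c Q' T₀) (oflipCM c hc2 t (oflipCM c hc2 t' Ψ)) = bpot c T₀ (oflipCM c hc2 t (oflipCM c hc2 t' Ψ)) →
          rt c Q' T₀ = rt c Q₁ T₀)) →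
      (∀ Q' : G, ddist (rt c Q' T₀) (oflipCM c hc2 s Ψ) = bpot c T₀ (oflipCM c hc2 s Ψ) → rt c Q' T₀ = rt c Q₂ T₀) ∧
      (∀ Q' : G, ddist (rt c Q' T₀) (oflipCM c hc2 s' Ψ) = bpot c T₀ (oflipCM c hc2 s' Ψ) → rt c Q' T₀ = rt c Q₂ T₀) ∧
      (∀ Q' : G, ddist (rt c Q' T₀) (oflipCM c hc2 s (oflipCM c hc2 s' Ψ)) = bpot c T₀ (oflipCM c hc2 s (oflipCM c hc2 s' Ψ)) →
        rt c Q' T₀ = rt c Q₂ T₀)))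

/-! ## §1 Level `m`: the transversal type in a multi-partner block -/

include hcen hbase hn hH hQ hQQ hLrt hcover in
/-- **STAR NORMAL FORM OF A TRANSVERSAL TYPE (multi-partner block).**  For a transversal `T ⊆ 𝓗 = T₀ ∖ T₁` of the swap `Q` (`t ∈ T ↔ σ_Q t ∉ T` on
`𝓗`) of size `m ≥ 2` such that at the type with deviation set `T` the only base changes at distance `m` are `T₀` and `T₁` (`htie`), every type `X` with
`D(X) ⊆ T` satisfies `[X] − θ_{T₀}(typeSum [X]) ∈ L`. [folklore] -/
theorem single_sub_thetaG_mem_transversal_partners (hm : 2 ≤ m)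
    (hσH : ∀ t ∈ T₀.1, ∀ t' ∈ T₀.1, (t' = t * Q ∨ t' = c * (t * Q)) → (t ∈ T₀.1 \ T₁.1 ↔ t' ∈ T₀.1 \ T₁.1))
    (T : Finset G) (hTH : T ⊆ T₀.1 \ T₁.1) (hTm : T.card = m)
    (hT : ∀ t ∈ T₀.1 \ T₁.1, ∀ t' ∈ T₀.1, (t' = t * Q ∨ t' = c * (t * Q)) → (t ∈ T ↔ t' ∉ T))
    (htie : ∀ X : CMF G c, T₀.1 \ X.1 = T → ∀ Q' : G, ddist (rt c Q' T₀) X = m → rt c Q' T₀ = T₀ ∨ rt c Q' T₀ = T₁) :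
    ∀ X : CMF G c, T₀.1 \ X.1 ⊆ T → Finsupp.single X 1 - thetaG c hc2 T₀ (typeSum G c (Finsupp.single X 1)) ∈ L := by
  refine single_sub_thetaG_mem_of c T₀ (fun X => T₀.1 \ X.1 ⊆ T) hc2 L fun X hX h2 => ?_
  -- corners stay in the class
  have hcorner : ∀ s ∈ T₀.1 \ X.1, T₀.1 \ (oflipCM c hc2 s X).1 ⊆ T := fun s hs =>
    (dev_oflip c hc2 (mem_sdiff.mp hs).1 (mem_sdiff.mp hs).2).symm ▸ (erase_subset _ _).trans hX
  have hcorner2 : ∀ s ∈ T₀.1 \ X.1, ∀ s' ∈ T₀.1 \ X.1, s ≠ s' → T₀.1 \ (oflipCM c hc2 s (oflipCM c hc2 s' X)).1 ⊆ T := by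
    intro s hs s' hs' hss'
    have hs'' : s ∈ T₀.1 \ (oflipCM c hc2 s' X).1 := by
      rw [dev_oflip c hc2 (mem_sdiff.mp hs').1 (mem_sdiff.mp hs').2]; exact mem_erase.mpr ⟨hss', hs⟩
    exact (dev_oflip c hc2 (mem_sdiff.mp hs'').1 (mem_sdiff.mp hs'').2).symm ▸ (erase_subset _ _).trans (hcorner s' hs')
  by_cases hXT : T₀.1 \ X.1 = T
  · -- the transversal type itself: a tie between `T₀` and `T₁` only (`htie`); the cover face or its `Q`-translate is toward `T₀`
    have hbp : bpot c T₀ X = m := by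
      rw [← hTm, ← hXT]
      exact bpot_eq_card_dev_of_le_m c T₀ 𝒯 hbase m hn hH hc2 hcen X (by rw [hXT, hTm])
    obtain ⟨Q₂, s, s', hQ₂, hs, hs', hss', hmem, -⟩ := hcover X (by rw [hbp]; omega)
    have hQ₂' : rt c Q₂ T₀ = T₀ ∨ rt c Q₂ T₀ = T₁ := htie X hXT Q₂ (by rw [← hQ₂, hbp])
    rcases hQ₂' with h0 | h1
    · rw [h0] at hs hs'
      exact ⟨s, s', hs, hs', hss', hmem, hcorner s hs, hcorner s' hs', hcorner2 s hs s' hs' hss'⟩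
    · -- translate the face by `Q`: `X` is `Q`-stable and `T₁·Q⁻¹ = T₀`
      have hstab : rt c Q X = X :=
        rt_eq_self_of_transversal c T₀ Q (T₀.1 \ T₁.1) (by rw [hQ]) hσH X T ∅ (by rw [union_empty]; exact hXT) hTH
          (empty_subset _) hT (fun t _ t' _ _ => by simp)
      have hT₁Q : rt c Q T₁ = T₀ := by rw [← hQ, ← rt_mul, hQQ, rt_one]
      have hmem' : gface c hc2 X (s * Q⁻¹) (s' * Q⁻¹) ∈ L := by
        have e : gface c hc2 X (s * Q⁻¹) (s' * Q⁻¹) = Finsupp.mapDomain (rt c Q) (gface c hc2 X s s') := by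
          rw [mapDomain_rt_gface, hstab]
        rw [e]; exact hLrt Q _ hmem
      have hsQ : s * Q⁻¹ ∈ T₀.1 \ X.1 := by
        rw [← hT₁Q, ← hstab, mem_sdiff_rt_iff, inv_mul_cancel_right, ← h1]; exact hs
      have hs'Q : s' * Q⁻¹ ∈ T₀.1 \ X.1 := by
        rw [← hT₁Q, ← hstab, mem_sdiff_rt_iff, inv_mul_cancel_right, ← h1]; exact hs'
      have hne : s * Q⁻¹ ≠ s' * Q⁻¹ := fun h => hss' (mul_right_cancel h)
      exact ⟨_, _, hsQ, hs'Q, hne, hmem', hcorner _ hsQ, hcorner _ hs'Q, hcorner2 _ hsQ _ hs'Q hne⟩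
  · -- strictly inside `T`: unique nearest base change `T₀`, whatever the partners
    have hlt : (T₀.1 \ X.1).card < m := by
      rw [← hTm]; exact card_lt_card (lt_of_le_of_ne hX hXT)
    have hbp : bpot c T₀ X = (T₀.1 \ X.1).card := bpot_eq_card_dev_of_le_m c T₀ 𝒯 hbase m hn hH hc2 hcen X hlt.le
    have huniq := unique_T₀_of_card_lt_m c T₀ 𝒯 hbase m hn hH hc2 hcen X hlt
    obtain ⟨s, s', hs, hs', hss', hmem⟩ := face_toward_T₀ c hc2 T₀ L hcover X (by rw [hbp]; exact h2) huniq
    exact ⟨s, s', hs, hs', hss', hmem, hcorner s hs, hcorner s' hs', hcorner2 s hs s' hs' hss'⟩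

/-! ## §2 The exchanged frame: star normal form toward `T₁` -/

include hcen hbase hn hH hpair hT₁ hQ hQQ hLrt hcover in
/-- **STAR NORMAL FORM TOWARD `T₁` OF THE TRANSVERSAL TYPE (multi-partner block)** — §1 in the exchanged frame `(T₁; T₀, Q)` whose partners are
`insert T₀ (𝒯.erase T₁)`: every type whose `T₁`-deviation set lies in `c·(𝓗 ∖ T)` has `[X] − θ_{T₁}(typeSum [X]) ∈ L`. [folklore] -/
theorem single_sub_thetaG_mem_transversal_partners_exchange (hm : 2 ≤ m)
    (hσH : ∀ t ∈ T₀.1, ∀ t' ∈ T₀.1, (t' = t * Q ∨ t' = c * (t * Q)) → (t ∈ T₀.1 \ T₁.1 ↔ t' ∈ T₀.1 \ T₁.1))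
    (T : Finset G) (hTH : T ⊆ T₀.1 \ T₁.1) (hTm : T.card = m)
    (hT : ∀ t ∈ T₀.1 \ T₁.1, ∀ t' ∈ T₀.1, (t' = t * Q ∨ t' = c * (t * Q)) → (t ∈ T ↔ t' ∉ T))
    (htie : ∀ X : CMF G c, T₀.1 \ X.1 = T → ∀ Q' : G, ddist (rt c Q' T₀) X = m → rt c Q' T₀ = T₀ ∨ rt c Q' T₀ = T₁) :
    ∀ X : CMF G c, T₁.1 \ X.1 ⊆ ((T₀.1 \ T₁.1) \ T).image (fun x => c * x) →
      Finsupp.single X 1 - thetaG c hc2 T₁ (typeSum G c (Finsupp.single X 1)) ∈ L := by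
  classical
  have hQ₁ : rt c Q T₁ = T₀ := by rw [← hQ, ← rt_mul, hQQ, rt_one]
  have hcov := cover_frame c hc2 T₀ L Q hcover
  simp only [hQ] at hcov
  have hsub : ((T₀.1 \ T₁.1) \ T).image (fun x => c * x) ⊆ T₁.1 \ T₀.1 := by
    intro x hx
    obtain ⟨u, hu, rfl⟩ := mem_image.mp hx
    obtain ⟨hu0, hu1⟩ := mem_sdiff.mp (mem_sdiff.mp hu).1
    exact mem_sdiff.mpr ⟨by by_contra h; exact hu1 ((T₁.2 u).mpr h), (T₀.2 u).mp hu0⟩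
  have hcard : (((T₀.1 \ T₁.1) \ T).image (fun x => c * x)).card = m := by
    rw [card_image_of_injective _ (mul_right_injective c), card_sdiff_of_subset hTH, hH T₁ hT₁, hTm]; omega
  -- the transversal type and its `T₁`-deviation set
  obtain ⟨Φ, hΦ⟩ := exists_type_of_dev c hc2 T₀ T (hTH.trans sdiff_subset)
  have hdev₁ : T₁.1 \ Φ.1 = ((T₀.1 \ T₁.1) \ T).image (fun x => c * x) := by
    rw [sdiff_eq_of_dev c hc2 T₀ T₁ Φ, hΦ, Finset.sdiff_eq_empty_iff_subset.mpr hTH, empty_union]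
  -- the tie hypothesis in the exchanged frame
  have htie₁ : ∀ X : CMF G c, T₁.1 \ X.1 = ((T₀.1 \ T₁.1) \ T).image (fun x => c * x) →
      ∀ Q' : G, ddist (rt c Q' T₁) X = m → rt c Q' T₁ = T₁ ∨ rt c Q' T₁ = T₀ := by
    intro X hX Q' hd
    have hXΦ : X = Φ := eq_of_dev_eq c T₁ (by rw [hX, hdev₁])
    subst hXΦ
    have e : rt c Q' T₁ = rt c (Q' * Q) T₀ := by rw [rt_mul, hQ]
    rw [e] at hd ⊢
    rcases htie X hΦ (Q' * Q) hd with h | h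
    · exact Or.inr h
    · exact Or.inl h
  exact single_sub_thetaG_mem_transversal_partners c hc2 hcen T₁ (insert T₀ (𝒯.erase T₁)) (hbase_exchange_partners c hbase hQ) m
    (card_frame c hc2 T₀ T₁ m hn) (card_sdiff_exchange_partners c hc2 T₀ 𝒯 m hH hpair hT₁) T₀ Q hQ₁ hQQ L hLrt hcov hm
    (swap_preserves_frame c hc2 T₀ T₁ Q hσH) _ hsub hcard (transversal_frame c hc2 T₀ T₁ Q hσH T hT) htie₁

/-! ## §3 The transversal relation at a dihedral-type partner -/

include hcen hbase hn hH hpair hT₁ hQ hQQ hLrt hcover in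
/-- **THE TRANSVERSAL RELATION `R(T) ∈ L` IN A MULTI-PARTNER BLOCK** (`m ≥ 2`): for every transversal `T ⊆ 𝓗` of the dihedral-type swap `Q` with
`|T| = m` whose type is a `T₀/T₁` tie only (`htie`), `Σ_{s∈T} f_s − Σ_{u∈𝓗∖T} g_u − (m−1)·(e₀ − e₁) ∈ L`. [folklore] -/
theorem rel_transversal_mem_partners (hm : 2 ≤ m)
    (hσH : ∀ t ∈ T₀.1, ∀ t' ∈ T₀.1, (t' = t * Q ∨ t' = c * (t * Q)) → (t ∈ T₀.1 \ T₁.1 ↔ t' ∈ T₀.1 \ T₁.1))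
    (T : Finset G) (hTH : T ⊆ T₀.1 \ T₁.1) (hTm : T.card = m)
    (hT : ∀ t ∈ T₀.1 \ T₁.1, ∀ t' ∈ T₀.1, (t' = t * Q ∨ t' = c * (t * Q)) → (t ∈ T ↔ t' ∉ T))
    (htie : ∀ X : CMF G c, T₀.1 \ X.1 = T → ∀ Q' : G, ddist (rt c Q' T₀) X = m → rt c Q' T₀ = T₀ ∨ rt c Q' T₀ = T₁) :
    ∑ s ∈ T, Finsupp.single (oflipCM c hc2 s T₀) (1 : ℤ) - ∑ u ∈ (T₀.1 \ T₁.1) \ T, Finsupp.single (oflipCM c hc2 u T₁) (1 : ℤ) -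
      ((m : ℤ) - 1) • (Finsupp.single T₀ (1 : ℤ) - Finsupp.single T₁ 1) ∈ L := by
  obtain ⟨Φ, hΦ⟩ := exists_type_of_dev c hc2 T₀ T (hTH.trans sdiff_subset)
  -- the two star normal forms of `Φ`
  have h0 := single_sub_thetaG_mem_transversal_partners c hc2 hcen T₀ 𝒯 hbase m hn hH T₁ Q hQ hQQ L hLrt hcover hm hσH T hTH hTm hT htie Φ
    (by rw [hΦ])
  have hdev₁ : T₁.1 \ Φ.1 = ((T₀.1 \ T₁.1) \ T).image (fun x => c * x) := by
    rw [sdiff_eq_of_dev c hc2 T₀ T₁ Φ, hΦ, Finset.sdiff_eq_empty_iff_subset.mpr hTH, empty_union]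
  have h1 := single_sub_thetaG_mem_transversal_partners_exchange c hc2 hcen T₀ 𝒯 hbase m hn hH hpair T₁ hT₁ Q hQ hQQ L hLrt hcover hm hσH T
    hTH hTm hT htie Φ (by rw [hdev₁])
  -- their difference
  have hdiff := Submodule.sub_mem _ h1 h0
  rw [sub_sub_sub_cancel_left, thetaG_typeSum_single c T₀ hc2 Φ, thetaG_frame c hc2 T₀ T₁ Φ, hΦ,
    Finset.sdiff_eq_empty_iff_subset.mpr hTH, sum_empty, zero_add] at hdiff
  have hcardD : (((T₀.1 \ T₁.1) \ T).card : ℤ) = m := by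
    have h : ((T₀.1 \ T₁.1) \ T).card = m := by rw [card_sdiff_of_subset hTH, hH T₁ hT₁, hTm]; omega
    exact_mod_cast h
  have hTm' : (T.card : ℤ) = m := by exact_mod_cast hTm
  have e : ∑ s ∈ T, Finsupp.single (oflipCM c hc2 s T₀) (1 : ℤ) - ∑ u ∈ (T₀.1 \ T₁.1) \ T, Finsupp.single (oflipCM c hc2 u T₁) (1 : ℤ) -
      ((m : ℤ) - 1) • (Finsupp.single T₀ (1 : ℤ) - Finsupp.single T₁ 1) =
      ((∑ t ∈ T, (Finsupp.single (oflipCM c hc2 t T₀) (1 : ℤ) - Finsupp.single T₀ 1)) + Finsupp.single T₀ 1) -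
      ((∑ u ∈ (T₀.1 \ T₁.1) \ T, (Finsupp.single (oflipCM c hc2 u T₁) (1 : ℤ) - Finsupp.single T₁ 1)) + Finsupp.single T₁ 1) := by
    rw [sum_sub_distrib, sum_sub_distrib, sum_const, sum_const, ← Nat.cast_smul_eq_nsmul ℤ, ← Nat.cast_smul_eq_nsmul ℤ, hcardD, hTm']
    module
  rw [e]
  exact hdiff

end Frame

end

end Summit.HodgeConjecture.CorCM.Census.CentralSquares
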